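/-
Copyright (c) 2026. All rights reserved.
Released under Apache 2.0 license as described in the file LICENSE.
Authors: abc-iut cell, prover seat abc-iut-w4-d095 (gen 7; row «SB′-CONTACT», abc-iut-L4-lead m136), over abc-iut-f-101's
frames (`LogFrobeniusMonoTelecoreFrameIsos/FrameLifts/Postcomp`), abc-iut-L4-t3's extended lifts
(`LogFrobeniusMonoTelecoreIotaFrames/IotaContact`) and this seat's `LogFrobeniusMonoTelecoreLamLifts(Theta)` (nothing restated); `⋉`-twin re-elaborated by prover seat
abc-iut-L4-t11 (gen 15) per the cell recipe LTIMES-RECIPE (owner abc-iut-L4-t3), statements unchanged.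
-/
import Literature.AnabelianGeometry.AbsoluteAnabelian.Ltimes.LogFrobeniusMonoTelecoreIotaContact
import Literature.AnabelianGeometry.AbsoluteAnabelian.Ltimes.LogFrobeniusMonoTelecoreLamLiftsTheta
import Literature.AnabelianGeometry.AbsoluteAnabelian.DiagramRelativeFamiliesUnion
import Literature.AnabelianGeometry.AbsoluteAnabelian.LogFrobeniusMonoTelecoreLamCross
import HarnessLib

/-!
# [AbsTopIII] Cor 5.10 (iv)(c): the CROSS post-composition law from the vertices `𝒩⊞_v` into the contact data of `ℋ_{An⊢}`

S. Mochizuki, *Topics in absolute anabelian geometry III: global reconstruction algorithms*,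
J. Math. Sci. Univ. Tokyo 22 (2015) 939–1156 [MochizukiAbsTopIII2015]; manuscript `paper:url-5493eb38cbb7`: Cor 5.10
(iv)(c) p. 148 l. 39–51 ("the resulting homotopies `η⊢_{v,ν}`, `(η⊢_{v,ν})⁻¹`, together with the mono-analyticization homotopies
and the homotopies on `D_{An⊢}` arising from the `ι^{An⊢⊞}_{v,ε}` … generate a contact structure `ℋ_{An⊢}` on `𝔗_{An⊢}` that is
compatible with … the homotopies of the observables `S_log`, `S_log⊞` of Corollary 5.5, (iii), that arise from the `ι⊞_{v,ε}`,
`ι_{v,ε}` indexed by `ε ∈ Γ⃗×_v`"), Def 3.5 (ii) p. 75 / §0 p. 26 (e) (post-composition), Rmk 3.5.1 p. 78.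

WHY THIS FILE (row «SB′-CONTACT», brick C₂; PROOF-SIDE, nothing restated).  The contact data at `{An⊢} ∪ {𝒩⊢⊞_v}`
(abc-iut-L4-t3's `monoRelLiftsIota`) and the `ι⊞`-pairs of `S_log⊞` at `{𝒩⊞_v}` (this seat's `lamRelLifts`) GLUE to one relative-lift
datum (`DiagramRelativeFamiliesUnion`) iff an `ι⊞`-pair post-composed (§0 (e)) with a path out of `𝒩⊞_v` is a contact pair with
the whiskered homotopy: into `An⊢` (uniqueness of lifts, `θN_over`), through `An⊢` then a telecore edge (`θI_comp_tel_heq`), or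
along `𝒩⊞_v → 𝒩⊢⊞_v` — where it is print's coherence: the extended lift of the CROSS-CLASS pair `(γ⁰_{v,ν₁}, γ⁰_{v,ν₂})` must be
`ι⊞` along `ν₁ ⤳ ν₂`, mono-analyticised (abc-iut-L4-t3's `EtaNaturalAt` pasted along chains, + `IotaOver`).

* `pathIso_gammaOnePrefix_inv_heq`, `θAt_gammaZero_gammaOne_app_heq`, `θAt_gammaOne_gammaZero_app_heq` — on the printed pairs the
  contact homotopy IS `(η⊢_{v,ν})⁻¹` resp. `η⊢_{v,ν}` (components; abc-iut-f-101's frames reduce to casts on the empty prefix);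
* `θI_gammaOne_app_heq` — the extended lift between `γ¹_{v,ν₁}`, `γ¹_{v,ν₂}` is the `γ¹`-side homotopy along the chain
  (`gammaOneChain`; uses `IotaOver` through `lamChain_over_app` and the naturality of `ι^{An⊢⊞}`);
* ★ `θI_gammaZero_app_heq` / `θI_gammaZero_heq` — **the extended lift between `γ⁰_{v,ν₁}`, `γ⁰_{v,ν₂}` IS `ι⊞` along `ν₁ ⤳ ν₂`
  mono-analyticised** (transitivity through `γ¹_{v,ν₁}`, `γ¹_{v,ν₂}` and the pasted square);
* ★ `lamCrossLaw` — the cross law `{𝒩⊞_v} → {An⊢} ∪ {𝒩⊢⊞_v}` (`RelLifts.CrossLaw`) GIVEN `EtaNaturalAt`, `IotaOver`, the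
  `ι^{An⊢⊞}`-square; `mwCrossLaw` — the other direction is vacuous (no path returns from the mono-analytic side to `𝒩⊞_v`).

Consumer: `LogFrobeniusMonoTelecoreContactObservables` (the union, the family, the closer of abc-iut-w5-d144's
`Cor510MonoContactObservablesCompatible`).  Refereed pre-IUT material; OUR constructions over a typed interface and its typed
add-ons (hypotheses BY NAME); nothing here bears on [IUTchIII] Cor. 3.12; no side taken; typed ≠ proved.

**`⋉`-TWIN (cell row «LTIMES-SUCCESSOR», L4-lead m162; typing finding T3g9-F1).**  This file is the verbatim
re-elaboration of `LogFrobeniusMonoTelecoreLamCross.lean` over the successor interface `LogFrobeniusSettingLtimes`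
(`Ltimes/LogFrobeniusCompatibility.lean`: `ι⊞_{v,ε}` indexed by the edges of `Γ⃗^⋉_v` at EVERY place, [AbsTopIII] Cor 5.5 (iii)
p. 131), produced by the cell recipe `LTIMES-RECIPE.md`: names carry over inside `namespace LogFrobeniusSettingLtimes`, the
section variable is `Lt`, setting-independent declarations are NOT repeated (the originals are in scope), statements and
proofs are otherwise unchanged.  The original file over the frozen interface stays as it is.
-/

set_option autoImplicit false

universe u

open CategoryTheory Quiver

namespace Literature.AnabelianGeometry.AbsoluteAnabelian

namespace LogFrobeniusSettingLtimes

-- setting-independent declarations of the original file (namespace `LogFrobeniusSetting`) re-exposed under the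
-- successor namespace (recipe rule 5); the originals are imported, not repeated.
export LogFrobeniusSetting (mrelI_gammaZero_gammaOne mrelI_gammaOne_gammaZero mrelI_gammaOne_gammaOne mrelI_gammaOne_gammaZero' mrelI_gammaZero_gammaZero whiskerRight_heq_of_heq_of_eq nplus_path_cases)

variable {Vmod : Type u} {isArc : Vmod → Bool} (Lt : LogFrobeniusSettingLtimes Vmod isArc)

  (hN : ∀ v : Vmod, Lt.monoN v ⋙ Lt.toEmono v ≅ Lt.toE v ⋙ Lt.monoAn)
  (hψ : ∀ (w : Vmod) (j : {ν : LogVertex (isArc w) // ν.IsCross}),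
    Lt.ψAnMono w j ⋙ Lt.forgetMono w ⋙ Lt.toEmono w ≅ Lt.κAnMono.inverse)
  (hη : ∀ (v : Vmod) (ν : LogVertex (isArc v)) (hν : ν.IsCross),
    Lt.lam v ν ⋙ Lt.forget v ⋙ Lt.toE v ⋙ Lt.monoAn ⋙ Lt.κAnMono.functor ⋙ Lt.ψAnMono v ⟨ν, hν⟩ ≅ Lt.lam v ν ⋙ Lt.monoNplus v)
  (I : Lt.IotaAnMono hψ)

-- the coherence hypothesis `hcoh`: «`η⊢_{v,ν}` lies over `ℰ⊢`» (abc-iut-f-101's binder, verbatim)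
variable (hcoh : ∀ (v : Vmod) (ν : LogVertex (isArc v)) (hν : ν.IsCross) (y : Lt.X),
  (Lt.toEmono v).map ((Lt.forgetMono v).map ((hη v ν hν).hom.app y)) ≫
    (Lt.toEmono v).map ((Lt.monoHomotopy v).hom.app ((Lt.lam v ν).obj y)) ≫
      (hN v).hom.app ((Lt.forget v).obj ((Lt.lam v ν).obj y)) =
  (hψ v ⟨ν, hν⟩).hom.app ((Lt.lam v ν ⋙ Lt.forget v ⋙ Lt.toE v ⋙ Lt.monoAn ⋙ Lt.κAnMono.functor).obj y) ≫
    Lt.κAnMono.unitIso.inv.app ((Lt.lam v ν ⋙ Lt.forget v ⋙ Lt.toE v ⋙ Lt.monoAn).obj y))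

/-! ## The frames of the printed paths on the empty prefix -/

section Frames

variable {v : Vmod}

/-- the structure isomorphism along `γ¹_{v,ν}` up to the core, componentwise: `(ℰ⊢ ⥲ An⊢)((ℰ• → ℰ⊢)(λ⊞_{v,ν} lies over))` (casts
stripped; abc-iut-f-101's `pathIso_gammaOnePrefix_heq` and `μ_lamE_app`). [cite: MochizukiAbsTopIII2015, Remark 3.5.1 p.78] -/
theorem pathIso_gammaOnePrefix_hom_heq (ν : LogVertex (isArc v)) (hν : ν.IsCross) (x : Lt.X) :
    ((Lt.monoTeleOver hN hψ).pathIso (gammaOnePrefix v ν hν)).hom.app x ≍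
      Lt.κAnMono.functor.map (Lt.monoAn.map ((Lt.lamOver v ν).hom.app x)) := by
  refine (Lt.pathIso_gammaOnePrefix_heq hN hψ (ν := ν) (hν := hν) x).trans ?_
  rw [Lt.μ_lamE_app hN hψ]
  try rfl

/-- … and its inverse: `(ℰ⊢ ⥲ An⊢)((ℰ• → ℰ⊢)((λ⊞_{v,ν} lies over)⁻¹))`. [cite: MochizukiAbsTopIII2015, Remark 3.5.1 p.78] -/
theorem pathIso_gammaOnePrefix_inv_heq (ν : LogVertex (isArc v)) (hν : ν.IsCross) (x : Lt.X) :
    ((Lt.monoTeleOver hN hψ).pathIso (gammaOnePrefix v ν hν)).inv.app x ≍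
      Lt.κAnMono.functor.map (Lt.monoAn.map ((Lt.lamOver v ν).inv.app x)) := by
  have e₁ : (Lt.monoTeleDiagram.pathFunctor (gammaOnePrefix v ν hν) ⋙ (Lt.monoTeleOver hN hψ).N (coreVx Vmod isArc)).obj x =
      Lt.κAnMono.functor.obj (Lt.monoAn.obj ((Lt.lam v ν ⋙ Lt.forget v ⋙ Lt.toE v).obj x)) := by
    rw [Lt.pathFunctor_gammaOnePrefix v ν hν]; rfl
  have key : ((Lt.monoTeleOver hN hψ).pathIso (gammaOnePrefix v ν hν)).hom.app x =
      eqToHom e₁ ≫ Lt.κAnMono.functor.map (Lt.monoAn.map ((Lt.lamOver v ν).hom.app x)) ≫ eqToHom rfl :=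
    (conj_eqToHom_iff_heq _ _ e₁ rfl).mpr (Lt.pathIso_gammaOnePrefix_hom_heq hN hψ ν hν x)
  have hiso : ((Lt.monoTeleOver hN hψ).pathIso (gammaOnePrefix v ν hν)).app x =
      eqToIso e₁ ≪≫ Lt.κAnMono.functor.mapIso (Lt.monoAn.mapIso ((Lt.lamOver v ν).app x)) := by
    ext
    rw [Iso.app_hom, key]
    simp only [Iso.trans_hom, eqToIso.hom, Functor.mapIso_hom, Iso.app_hom, eqToHom_refl, Category.comp_id]
  have hinv := congrArg Iso.inv hiso
  rw [Iso.app_inv] at hinv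
  rw [hinv]
  simp only [Iso.trans_inv, eqToIso.inv, Functor.mapIso_inv, Iso.app_inv]
  exact comp_eqToHom_heq _ _

variable (ν : LogVertex (isArc v)) (hν : ν.IsCross)

/-- the two frames of `γ¹_{v,ν}` (prefix `γ¹pre` / `[] ∘ γ¹pre`) cancel. [cite: MochizukiAbsTopIII2015, Remark 3.5.1 p.78] -/
theorem ΘT_gammaOne_hom_inv_app (x : Lt.X) :
    (Lt.ΘT hN hψ (p := ((Path.nil : Path (boxVx Vmod isArc) _).comp (gammaOnePrefix v ν hν)).cons (telE v ν hν))
        ⟨Path.nil.comp (gammaOnePrefix v ν hν), rfl⟩).hom.app x ≫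
      (Lt.ΘT hN hψ (p := gammaOne v ν hν) ⟨gammaOnePrefix v ν hν, rfl⟩).inv.app x = 𝟙 _ := by
  change ((Lt.ΘT hN hψ (p := gammaOne v ν hν) ⟨gammaOnePrefix v ν hν, rfl⟩).hom ≫
    (Lt.ΘT hN hψ (p := gammaOne v ν hν) ⟨gammaOnePrefix v ν hν, rfl⟩).inv).app x = _
  rw [Iso.hom_inv_id, NatTrans.id_app]
  try rfl

/-- … in the other order. [cite: MochizukiAbsTopIII2015, Remark 3.5.1 p.78] -/
theorem ΘT_gammaOne_hom_inv_app' (x : Lt.X) :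
    (Lt.ΘT hN hψ (p := gammaOne v ν hν) ⟨gammaOnePrefix v ν hν, rfl⟩).hom.app x ≫
      (Lt.ΘT hN hψ (p := ((Path.nil : Path (boxVx Vmod isArc) _).comp (gammaOnePrefix v ν hν)).cons (telE v ν hν))
        ⟨Path.nil.comp (gammaOnePrefix v ν hν), rfl⟩).inv.app x = 𝟙 _ := by
  change ((Lt.ΘT hN hψ (p := gammaOne v ν hν) ⟨gammaOnePrefix v ν hν, rfl⟩).hom ≫
    (Lt.ΘT hN hψ (p := gammaOne v ν hν) ⟨gammaOnePrefix v ν hν, rfl⟩).inv).app x = _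
  rw [Iso.hom_inv_id, NatTrans.id_app]
  try rfl

/-- **on the printed pair `(γ⁰_{v,ν}, γ¹_{v,ν})` the contact homotopy IS `(η⊢_{v,ν})⁻¹`**, componentwise (abc-iut-f-101's framed lift
`Θ_{γ⁰} ≫ Θ_{γ¹}⁻¹`: the `γ⁰`-frame is `(η⊢)⁻¹` followed by the `γ¹`-frame). [cite: MochizukiAbsTopIII2015, Cor 5.10 (iv)(c) p.148] -/
theorem θAt_gammaZero_gammaOne_app_heq (hr : MRel (gammaZero v ν hν) (gammaOne v ν hν)) (x : Lt.X) :
    (Lt.θAt hN hψ hη hr).app x ≍ (hη v ν hν).inv.app x := by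
  rw [Lt.θAt_eq hN hψ hη hr (.inr ⟨Path.nil, rfl⟩) (.inl ⟨gammaOnePrefix v ν hν, rfl⟩), NatTrans.comp_app]
  change (Lt.ΘL hN hψ hη (p := gammaZero v ν hν) ⟨Path.nil, rfl⟩).hom.app x ≫
    (Lt.ΘT hN hψ (p := gammaOne v ν hν) ⟨gammaOnePrefix v ν hν, rfl⟩).inv.app x ≍ _
  rw [Lt.ΘL_hom_app hN hψ hη]
  simp only [Category.assoc]
  rw [Lt.ΘT_gammaOne_hom_inv_app hN hψ ν hν x]
  erw [Category.comp_id]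
  refine (eqToHom_comp_heq _ _).trans ((comp_eqToHom_heq _ _).trans ?_)
  exact app_heq' (hη v ν hν).inv (Functor.congr_obj (Lt.monoTeleDiagram.pathFunctor_nil (boxVx Vmod isArc)) x)

/-- **on `(γ¹_{v,ν}, γ⁰_{v,ν})` it IS `η⊢_{v,ν}`**, componentwise. [cite: MochizukiAbsTopIII2015, Cor 5.10 (iv)(c) p.148] -/
theorem θAt_gammaOne_gammaZero_app_heq (hr : MRel (gammaOne v ν hν) (gammaZero v ν hν)) (x : Lt.X) :
    (Lt.θAt hN hψ hη hr).app x ≍ (hη v ν hν).hom.app x := by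
  rw [Lt.θAt_eq hN hψ hη hr (.inl ⟨gammaOnePrefix v ν hν, rfl⟩) (.inr ⟨Path.nil, rfl⟩), NatTrans.comp_app]
  change (Lt.ΘT hN hψ (p := gammaOne v ν hν) ⟨gammaOnePrefix v ν hν, rfl⟩).hom.app x ≫
    (Lt.ΘL hN hψ hη (p := gammaZero v ν hν) ⟨Path.nil, rfl⟩).inv.app x ≍ _
  simp only [ΘL, Iso.trans_inv, Iso.symm_inv, eqToIso.inv, NatTrans.comp_app, eqToHom_app, Functor.isoWhiskerLeft_inv,
    Functor.whiskerLeft_app, Category.assoc]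
  rw [← Category.assoc, Lt.ΘT_gammaOne_hom_inv_app' hN hψ ν hν x]
  erw [Category.id_comp]
  refine (eqToHom_comp_heq _ _).trans ((comp_eqToHom_heq _ _).trans ?_)
  exact app_heq' (hη v ν hν).hom (Functor.congr_obj (Lt.monoTeleDiagram.pathFunctor_nil (boxVx Vmod isArc)) x)

end Frames

/-! ## The extended lift between `γ¹_{v,ν₁}` and `γ¹_{v,ν₂}` -/

section GammaOne

variable {v : Vmod}

/-- **the extended lift between `γ¹_{v,ν₁}`, `γ¹_{v,ν₂}` (`ν₁ ⤳ ν₂`) is the `γ¹`-side homotopy along the chain**, componentwise: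
`θI = Θ_{γ¹₁} ≫ (N_□ ◁ ι^{An⊢⊞} along the chain) ≫ Θ_{γ¹₂}⁻¹` with both frames `(κ∘monoAn)(lamOver)` under `ψ`; the naturality of
`ι^{An⊢⊞}` moves the second frame across, and `lamOver₁ ≫ lamOver₂⁻¹` is `ι⊞` along the chain over `Th•[Z]` (`IotaOver`).
[cite: MochizukiAbsTopIII2015, Cor 5.10 (iv)(c) p.148] -/
theorem θI_gammaOne_app_heq (hιO : Lt.IotaOver) {ν₁ ν₂ : LogVertex (isArc v)} (h : ν₁.Reach ν₂)
    (hr : MRelI (gammaOne v ν₁ h.isCross_src) (gammaOne v ν₂ h.isCross_tgt)) (x : Lt.X) :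
    (Lt.θI hN hψ hη I hr).app x ≍ (I.gammaOneChain v h).app x := by
  rw [Lt.θI_eq hN hψ hη I hr (.inl ⟨gammaOnePrefix v ν₁ _, rfl⟩) (.inl ⟨gammaOnePrefix v ν₂ _, rfl⟩) h,
    NatTrans.comp_app, NatTrans.comp_app, Functor.whiskerLeft_app]
  change (Lt.ΘT hN hψ (p := gammaOne v ν₁ _) ⟨gammaOnePrefix v ν₁ _, rfl⟩).hom.app x ≫
    (I.chain v h).app (((Lt.monoTeleOver hN hψ).N (boxVx Vmod isArc)).obj x) ≫
      (Lt.ΘT hN hψ (p := gammaOne v ν₂ _) ⟨gammaOnePrefix v ν₂ _, rfl⟩).inv.app x ≍ _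
  rw [Lt.ΘT_hom_app hN hψ, Lt.ΘT_inv_app hN hψ]
  have e₁ : (Lt.monoTeleDiagram.pathFunctor (gammaOne v ν₁ h.isCross_src)).obj x =
      (Lt.ψAnMono v ⟨ν₁, h.isCross_src⟩).obj
        ((Lt.monoTeleDiagram.pathFunctor (gammaOnePrefix v ν₁ h.isCross_src)).obj x) :=
    Functor.congr_obj (LogFrobeniusSettingLtimes.TelWit.pathFunctor_eq Lt
      (⟨gammaOnePrefix v ν₁ _, rfl⟩ : TelWit v ν₁ h.isCross_src (gammaOne v ν₁ h.isCross_src))) x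
  have e₂ : (Lt.monoTeleDiagram.pathFunctor (gammaOne v ν₂ h.isCross_tgt)).obj x =
      (Lt.ψAnMono v ⟨ν₂, h.isCross_tgt⟩).obj
        ((Lt.monoTeleDiagram.pathFunctor (gammaOnePrefix v ν₂ h.isCross_tgt)).obj x) :=
    Functor.congr_obj (LogFrobeniusSettingLtimes.TelWit.pathFunctor_eq Lt
      (⟨gammaOnePrefix v ν₂ _, rfl⟩ : TelWit v ν₂ h.isCross_tgt (gammaOne v ν₂ h.isCross_tgt))) x
  refine (heq_comp e₁ rfl e₂ (eqToHom_comp_heq _ _)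
    (heq_comp rfl rfl e₂ (HEq.refl _) (comp_eqToHom_heq _ _))).trans ?_
  erw [← I.chain_naturality v h, ← Category.assoc, ← Functor.map_comp]
  rw [I.gammaOneChain_app]
  have hπ : ((Lt.monoTeleOver hN hψ).pathIso (gammaOnePrefix v ν₁ h.isCross_src)).hom.app x ≫
      ((Lt.monoTeleOver hN hψ).pathIso (gammaOnePrefix v ν₂ h.isCross_tgt)).inv.app x ≍
      (Lt.forget v ⋙ Lt.toE v ⋙ Lt.monoAn ⋙ Lt.κAnMono.functor).map ((Lt.lamChain v h).app x) := by
    refine (heq_comp ?_ rfl ?_ (Lt.pathIso_gammaOnePrefix_hom_heq hN hψ ν₁ _ x)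
      (Lt.pathIso_gammaOnePrefix_inv_heq hN hψ ν₂ _ x)).trans ?_
    · rw [Lt.pathFunctor_gammaOnePrefix]; rfl
    · rw [Lt.pathFunctor_gammaOnePrefix]; rfl
    · refine heq_of_eq ?_
      erw [← Functor.map_comp, ← Functor.map_comp, ← Lt.lamChain_over_app hιO v h]
      rfl
  exact heq_comp (by first | rfl | (rw [Lt.pathFunctor_gammaOnePrefix]; try rfl))
    (by first | rfl | (rw [Lt.pathFunctor_gammaOnePrefix]; try rfl))
    (by first | rfl | (rw [Lt.pathFunctor_gammaOnePrefix]; try rfl))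
    (map_heq' (Lt.ψAnMono v ⟨ν₁, h.isCross_src⟩) (by first | rfl | (rw [Lt.pathFunctor_gammaOnePrefix]; try rfl))
      (by first | rfl | (rw [Lt.pathFunctor_gammaOnePrefix]; try rfl)) hπ)
    (app_heq' (I.chain v h) (by first | rfl | (rw [Lt.pathFunctor_gammaOnePrefix]; try rfl)))

end GammaOne

/-! ## The extended lift between `γ⁰_{v,ν₁}` and `γ⁰_{v,ν₂}` -/

section GammaZero

variable {v : Vmod}

/-- ★ **the extended lift between the CROSS-CLASS pair `(γ⁰_{v,ν₁}, γ⁰_{v,ν₂})` IS `ι⊞` along `ν₁ ⤳ ν₂`, mono-analyticised**,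
componentwise — GIVEN the `ι^{An⊢⊞}`-square (transitivity of the extended lifts), abc-iut-L4-t3's `η⊢`-naturality square and
`IotaOver`: through `γ¹_{v,ν₁}`, `γ¹_{v,ν₂}` the lift is `(η⊢_{ν₁})⁻¹ ≫ (γ¹-side homotopy along the chain) ≫ η⊢_{ν₂}`, which the pasted
square identifies with `(𝒩⊞_v → 𝒩⊢⊞_v)(ι⊞ along the chain)`. [cite: MochizukiAbsTopIII2015, Cor 5.10 (iv)(c) p.148] -/
theorem θI_gammaZero_app_heq (hsqI : I.SquaresCommute) (hEta : I.EtaNaturalAt hη) (hιO : Lt.IotaOver)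
    {ν₁ ν₂ : LogVertex (isArc v)} (h : ν₁.Reach ν₂)
    (hr : MRelI (gammaZero v ν₁ h.isCross_src) (gammaZero v ν₂ h.isCross_tgt)) (x : Lt.X) :
    (Lt.θI hN hψ hη I hr).app x ≍ (Lt.monoNplus v).map ((Lt.lamChain v h).app x) := by
  rw [← Lt.θI_trans hN hψ hη I hsqI (mrelI_gammaZero_gammaOne ν₁ h.isCross_src) (mrelI_gammaOne_gammaZero' h) hr,
    ← Lt.θI_trans hN hψ hη I hsqI (mrelI_gammaOne_gammaOne h) (mrelI_gammaOne_gammaZero ν₂ h.isCross_tgt)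
      (mrelI_gammaOne_gammaZero' h),
    NatTrans.comp_app, NatTrans.comp_app,
    Lt.θI_eq_θAt hN hψ hη I (mrelI_gammaZero_gammaOne ν₁ _)
      ⟨ν₁, _, Or.inr ⟨⟨Path.nil, rfl⟩⟩, inA_cons_telE _ (gammaOnePrefix v ν₁ _)⟩,
    Lt.θI_eq_θAt hN hψ hη I (mrelI_gammaOne_gammaZero ν₂ _)
      ⟨ν₂, _, inA_cons_telE _ (gammaOnePrefix v ν₂ _), Or.inr ⟨⟨Path.nil, rfl⟩⟩⟩]
  have e₀₁ : (Lt.monoTeleDiagram.pathFunctor (gammaZero v ν₁ h.isCross_src)).obj x = (Lt.lam v ν₁ ⋙ Lt.monoNplus v).obj x :=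
    Functor.congr_obj (Lt.pathFunctor_gammaZero v ν₁ _) x
  have e₀₂ : (Lt.monoTeleDiagram.pathFunctor (gammaZero v ν₂ h.isCross_tgt)).obj x = (Lt.lam v ν₂ ⋙ Lt.monoNplus v).obj x :=
    Functor.congr_obj (Lt.pathFunctor_gammaZero v ν₂ _) x
  have e₁₁ : (Lt.monoTeleDiagram.pathFunctor (gammaOne v ν₁ h.isCross_src)).obj x =
      (Lt.lam v ν₁ ⋙ Lt.forget v ⋙ Lt.toE v ⋙ Lt.monoAn ⋙ Lt.κAnMono.functor ⋙ Lt.ψAnMono v ⟨ν₁, h.isCross_src⟩).obj x :=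
    Functor.congr_obj (Lt.pathFunctor_gammaOne v ν₁ _) x
  have e₁₂ : (Lt.monoTeleDiagram.pathFunctor (gammaOne v ν₂ h.isCross_tgt)).obj x =
      (Lt.lam v ν₂ ⋙ Lt.forget v ⋙ Lt.toE v ⋙ Lt.monoAn ⋙ Lt.κAnMono.functor ⋙ Lt.ψAnMono v ⟨ν₂, h.isCross_tgt⟩).obj x :=
    Functor.congr_obj (Lt.pathFunctor_gammaOne v ν₂ _) x
  refine (heq_comp e₀₁ e₁₁ e₀₂ (Lt.θAt_gammaZero_gammaOne_app_heq hN hψ hη ν₁ _ _ x)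
    (heq_comp e₁₁ e₁₂ e₀₂ (Lt.θI_gammaOne_app_heq hN hψ hη I hιO h _ x)
      (Lt.θAt_gammaOne_gammaZero_app_heq hN hψ hη ν₂ _ _ x))).trans ?_
  exact heq_of_eq (I.eta_inv_comp_gammaOneChain_app hEta v h x)

/-- ★ the same, as natural transformations: **`θI (γ⁰_{v,ν₁}, γ⁰_{v,ν₂}) ≍ (ι⊞ along the chain) ▷ (𝒩⊞_v → 𝒩⊢⊞_v)`**.
[cite: MochizukiAbsTopIII2015, Cor 5.10 (iv)(c) p.148] -/
theorem θI_gammaZero_heq (hsqI : I.SquaresCommute) (hEta : I.EtaNaturalAt hη) (hιO : Lt.IotaOver)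
    {ν₁ ν₂ : LogVertex (isArc v)} (h : ν₁.Reach ν₂)
    (hr : MRelI (gammaZero v ν₁ h.isCross_src) (gammaZero v ν₂ h.isCross_tgt)) :
    Lt.θI hN hψ hη I hr ≍ Functor.whiskerRight (Lt.lamChainD v h) (Lt.monoTeleDiagram.map (monoE v)) :=
  natTrans_heq_of_app (Lt.pathFunctor_gammaZero v ν₁ _) (Lt.pathFunctor_gammaZero v ν₂ _)
    fun x => Lt.θI_gammaZero_app_heq hN hψ hη I hsqI hEta hιO h hr x

end GammaZero

/-! ## The cross law -/

section Cross

variable {v : Vmod} {a : (monoTeleShape Vmod isArc).Vertex}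

/-- the functor of the single arrow `𝒩⊞_v → 𝒩⊢⊞_v`, as a path. [cite: MochizukiAbsTopIII2015, Definition 3.5 (i) p.75] -/
theorem pathFunctor_monoE_eq (v : Vmod) :
    Lt.monoTeleDiagram.pathFunctor ((Path.nil : Path (nplusVx (isArc := isArc) v) _).cons (monoE v)) =
      Lt.monoTeleDiagram.map (monoE (isArc := isArc) v) := by
  rw [DiagramOfCategories.pathFunctor_cons, Lt.monoTeleDiagram.pathFunctor_nil]
  exact Functor.id_comp _

variable (hsq : ∀ v : Vmod, Lt.IotaCoreSquaresCommute v) (hsqI : I.SquaresCommute)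

include hcoh in
/-- ★ **the cross post-composition law from `{𝒩⊞_v}` into `{An⊢} ∪ {𝒩⊢⊞_v}`** (§0 (e) across the two data): an `ι⊞`-pair
post-composed with a path out of `𝒩⊞_v` is an (extended) contact pair, and its homotopy is the whiskered one — into `An⊢` by
uniqueness of lifts (`θN_over`), through a telecore edge by abc-iut-L4-t3's `θI_comp_tel_heq`, along `𝒩⊞_v → 𝒩⊢⊞_v` by
`θI_gammaZero_heq` (the pasted `η⊢`-square). [cite: MochizukiAbsTopIII2015, Definition 3.5 (ii) p.75] -/
theorem lamCrossLaw (hEta : I.EtaNaturalAt hη) (hιO : Lt.IotaOver) :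
    DiagramOfCategories.RelLifts.CrossLaw (Lt.lamRelLifts hsq) (Lt.monoRelLiftsIota hN hψ hη I hcoh hsqI) := by
  constructor
  · intro a w w' p q t hw hw' h
    obtain ⟨v, rfl⟩ := eq_of_nw hw
    obtain ⟨ν₁, ν₂, hν₁, hν₂, hreach, ⟨wt⟩⟩ := (nrel_nplus_iff p q).mp h
    obtain ⟨R, rfl, rfl⟩ := wt
    revert hw'
    refine fun hw' => nplus_path_cases (v := v)
      (fun w' hw' t => MRelI ((R.cons (lamE v ν₁ hν₁)).comp t) ((R.cons (lamE v ν₂ hν₂)).comp t)) ?_ ?_ ?_ hw' t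
    · intro _ _
      trivial
    · intro _
      exact ⟨ν₁, ν₂, hν₁, hν₂, inA_comp_gammaZero hν₁ R, inA_comp_gammaZero hν₂ R, hreach⟩
    · intro v' ν' hν' hw' t₀
      exact mrelI_of_mrel hw' ⟨ν', hν', inA_cons_telE hν' _, inA_cons_telE hν' _⟩
  · intro a w w' hw hw' p q t h h'
    obtain ⟨v, rfl⟩ := eq_of_nw hw
    change Lt.MθI hN hψ hη I hw' h' ≍ Functor.whiskerRight (Lt.θN h) (Lt.monoTeleDiagram.pathFunctor t)
    have hover : ∀ x, ((Lt.monoTeleOver hN hψ).N (nplusVx v)).map ((Lt.θN h).app x) =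
        ((Lt.monoTeleOver hN hψ).pathIso p).hom.app x ≫ ((Lt.monoTeleOver hN hψ).pathIso q).inv.app x :=
      fun x => Lt.θN_over hN hψ hιO h x
    revert hw' h'
    refine fun hw' => nplus_path_cases (v := v)
      (fun w' hw' t => ∀ h' : MRelI (p.comp t) (q.comp t),
        Lt.MθI hN hψ hη I hw' h' ≍ Functor.whiskerRight (Lt.θN h) (Lt.monoTeleDiagram.pathFunctor t)) ?_ ?_ ?_ hw' t
    · intro hw' t h'
      rw [Lt.MθI_obs hN hψ hη I]
      exact Lt.lift_comp_heq_of_over hN hψ (Lt.θN h) hover t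
    · intro hw' h'
      rw [Lt.MθI_nmonoPlus hN hψ hη I]
      obtain ⟨ν₁, ν₂, hν₁, hν₂, hreach, ⟨wt⟩⟩ := h
      rw [Lt.θN_eq _ wt hreach]
      obtain ⟨R, rfl, rfl⟩ := wt
      have hr₀ : MRelI (gammaZero v ν₁ hν₁) (gammaZero v ν₂ hν₂) := mrelI_gammaZero_gammaZero hreach
      have hpre := Lt.θI_precomp_heq hN hψ hη I R hr₀ h'
      refine hpre.trans ?_
      refine (whiskerLeft_heq_of_heq (Lt.monoTeleDiagram.pathFunctor R) (Lt.pathFunctor_gammaZero v ν₁ hν₁)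
        (Lt.pathFunctor_gammaZero v ν₂ hν₂) (Lt.θI_gammaZero_heq hN hψ hη I hsqI hEta hιO hreach hr₀)).trans ?_
      refine HEq.trans (b := Functor.whiskerRight (Functor.whiskerLeft (Lt.monoTeleDiagram.pathFunctor R)
        (Lt.lamChainD v hreach)) (Lt.monoTeleDiagram.map (monoE v))) HEq.rfl ?_
      exact whiskerRight_heq_of_heq_of_eq (DiagramOfCategories.pathFunctor_cons _ _ _).symm
        (DiagramOfCategories.pathFunctor_cons _ _ _).symm
        ((LogFrobeniusSettingLtimes.NWit.θ_heq Lt (⟨R, rfl, rfl⟩ : NWit v ν₁ ν₂ hν₁ hν₂ _ _) hreach).symm) (Lt.pathFunctor_monoE_eq v).symm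
    · intro v' ν' hν' hw' t₀ h'
      rw [Lt.MθI_nmonoPlus hN hψ hη I]
      exact Lt.θI_comp_tel_heq hN hψ hη I (Lt.θN h) hover t₀ ν' hν' h'

/-- **the cross law in the other direction is vacuous**: no path of `Γ⃗_{D_{An⊢}}` leads from `An⊢` or from `𝒩⊢⊞_{v′}` to a vertex
`𝒩⊞_v` (abc-iut-f-101's `isEmpty_path_obs_nplus`, `isEmpty_path_nmonoPlus_nplus`). [cite: MochizukiAbsTopIII2015, Cor 5.10 (iv)(b) p.147] -/
theorem mwCrossLaw :
    DiagramOfCategories.RelLifts.CrossLaw (Lt.monoRelLiftsIota hN hψ hη I hcoh hsqI) (Lt.lamRelLifts hsq) := by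
  refine DiagramOfCategories.RelLifts.CrossLaw.of_isEmpty_path fun w w' hw hw' => ?_
  obtain ⟨v, rfl⟩ := eq_of_nw hw'
  rcases eq_of_mw hw with rfl | ⟨v', rfl⟩
  · exact isEmpty_path_obs_nplus v (monoBase_six_nplus v)
  · exact isEmpty_path_nmonoPlus_nplus v' v (monoBase_six_nmonoPlus v') (monoBase_six_nplus v)

end Cross


end LogFrobeniusSettingLtimes

end Literature.AnabelianGeometry.AbsoluteAnabelian
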